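import Summits.QuantumFields.GaugeBoot.BootstrapConvergence
import Mathlib.LinearAlgebra.Matrix.PosDef
import HarnessLib

/-!
# The truncated bootstrap is a semidefinite feasibility problem: square-positivity on a span = PSD moment matrix (gauge-boot, L1 supplement)

HONEST FRAMING (cell `pub-gaugeboot`, page 1 of every file): the venture produces certified bounds
on lattice expectations at stated coupling, gauge group, dimension and torus size; NOT a mass gap,
NOT a continuum limit, NOT a string tension; NOT Yang–Mills-summit-bearing (barriers
`FixedCouplingUltralocality`, `PerturbativeInvisibility`). Structural; it certifies no number.

## Content

The abstract positivity constraint (P) "`0 ≤ φ (a a)` for every test function `a` in the level-`n`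
space" of `IsBootstrapFeasible` IS the SDP constraint an implementation imposes:

* `momentMatrix φ v` — `M_{ij} = φ (v_i v_j)` for a finite family `v` of observables;
  `momentMatrix_isHermitian`; `map_sq_sum_smul` — `φ ((Σ c_i v_i)²) = cᵀ M c`;
* ★★ `sqPositive_span_iff_posSemidef` — square-positivity of `φ` on `span {v_i}` ⇔ `M` is
  POSITIVE SEMI-DEFINITE (`Matrix.PosSemidef`);
* ★★ `isBootstrapFeasible_span_iff` — for a finite family of polynomial test functions,
  feasibility for the bootstrap with test-function set `span {v_i}` ⇔ `φ 1 = 1`, the moment matrix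
  is PSD, and the finitely many loop equations with test functions `v_i` hold (rows are linear in
  the test function; derivatives of sums are sums of derivatives): a normalisation, ONE semidefinite
  constraint and finitely many linear equalities in the unknowns `φ(word)` — an SDP.

So the convergence theorems of `BootstrapConvergence.lean` / `BootstrapWordTruncation.lean` are
statements about the actual semidefinite programs of the lattice bootstrap (with all words of
length `≤ n` as test functions).

References: P. Anderson, M. Kruczenski, Nucl. Phys. B 921 (2017) §3; V. Kazakov, Z. Zheng,
arXiv:2203.11360 §2.2 (positivity matrices); J. B. Lasserre, SIAM J. Optim. 11 (2001) (moment
matrices). Folklore.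
-/

noncomputable section

open MeasureTheory Filter Topology NormedSpace Matrix
open Literature.MathematicalPhysics.QuantumFieldTheory (LatticeRep)

namespace Summit.QuantumFields.GaugeBoot

/-! ## Moment matrices -/

section Moment

variable {Ω : Type*} [TopologicalSpace Ω] {σ : Type*} [Fintype σ]

/-- **The moment matrix** of a finite family of observables under a linear functional:
`M_{ij} = φ (v_i v_j)`. [folklore] -/
def momentMatrix (φ : C(Ω, ℝ) →ₗ[ℝ] ℝ) (v : σ → C(Ω, ℝ)) : Matrix σ σ ℝ :=
  Matrix.of fun i j => φ (v i * v j)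

omit [Fintype σ] in
/-- `momentMatrix` evaluated. -/
@[simp] theorem momentMatrix_apply (φ : C(Ω, ℝ) →ₗ[ℝ] ℝ) (v : σ → C(Ω, ℝ)) (i j : σ) :
    momentMatrix φ v i j = φ (v i * v j) := rfl

omit [Fintype σ] in
/-- The moment matrix is symmetric (the observables commute). -/
theorem momentMatrix_isHermitian (φ : C(Ω, ℝ) →ₗ[ℝ] ℝ) (v : σ → C(Ω, ℝ)) :
    (momentMatrix φ v).IsHermitian := by
  ext i j
  simp [momentMatrix, mul_comm]

/-- **`φ ((Σ c_i v_i)²) = cᵀ M c`.** [folklore] -/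
theorem map_sq_sum_smul (φ : C(Ω, ℝ) →ₗ[ℝ] ℝ) (v : σ → C(Ω, ℝ)) (c : σ → ℝ) :
    φ ((∑ i, c i • v i) * (∑ j, c j • v j)) = c ⬝ᵥ (momentMatrix φ v *ᵥ c) := by
  have h : (∑ i, c i • v i) * (∑ j, c j • v j) = ∑ i, ∑ j, (c i * c j) • (v i * v j) := by
    rw [Finset.sum_mul]
    refine Finset.sum_congr rfl fun i _ => ?_
    rw [Finset.mul_sum]
    refine Finset.sum_congr rfl fun j _ => ?_
    rw [smul_mul_smul_comm]
  rw [h, map_sum]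
  simp only [map_sum, map_smul, smul_eq_mul, dotProduct, Matrix.mulVec, momentMatrix_apply,
    Finset.mul_sum]
  refine Finset.sum_congr rfl fun i _ => Finset.sum_congr rfl fun j _ => ?_
  ring

/-- ★★ **Square-positivity on a span ⇔ the moment matrix is positive semi-definite.** [folklore] -/
theorem sqPositive_span_iff_posSemidef (φ : C(Ω, ℝ) →ₗ[ℝ] ℝ) (v : σ → C(Ω, ℝ)) :
    (∀ a ∈ Submodule.span ℝ (Set.range v), 0 ≤ φ (a * a)) ↔ (momentMatrix φ v).PosSemidef := by
  constructor
  · intro h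
    refine Matrix.PosSemidef.of_dotProduct_mulVec_nonneg (momentMatrix_isHermitian φ v) fun c => ?_
    have hmem : ∑ i, c i • v i ∈ Submodule.span ℝ (Set.range v) :=
      Submodule.sum_mem _ fun i _ => Submodule.smul_mem _ _ (Submodule.subset_span ⟨i, rfl⟩)
    have h1 := h _ hmem
    rw [map_sq_sum_smul] at h1
    simpa using h1
  · intro hM a ha
    obtain ⟨c, rfl⟩ := (Submodule.mem_span_range_iff_exists_fun ℝ).1 ha
    rw [map_sq_sum_smul]
    simpa using hM.dotProduct_mulVec_nonneg c

end Moment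

/-! ## Feasibility with a finite-dimensional test space is an SDP -/

section SDP

variable {ι : Type*} [DecidableEq ι] [Countable ι] {G : Type*} [Group G] [TopologicalSpace G]
  [IsTopologicalGroup G] [CompactSpace G] [MeasurableSpace G] [BorelSpace G]
  [SecondCountableTopology G] (r : LatticeRep G) {K : Type*} {k : K → ℝ → G}
  {X : K → Matrix (Fin r.N) (Fin r.N) ℂ} {S : ι → (ι → G) → ℝ} {β : ℝ} {σ : Type*} [Fintype σ]

omit [Countable ι] [CompactSpace G] [MeasurableSpace G] [BorelSpace G] [SecondCountableTopology G] in
/-- **Rows are linear in the test function.** If the loop equation holds for each `v_j` (with its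
polynomial derivative), it holds for every element of their span: the derivative of `Σ c_j v_j` along
the shift is `Σ c_j v_j'` (uniqueness of derivatives). [folklore] -/
theorem row_of_rows_span (hk : ∀ a s t, k a (s + t) = k a s * k a t)
    (hX : ∀ a t, r.ρ (k a t) = exp ((t : ℂ) • X a)) {φ : C(ι → G, ℝ) →ₗ[ℝ] ℝ}
    {v : σ → C(ι → G, ℝ)} (hv : ∀ j, v j ∈ polyAlgebra (ι := ι) r) (i : ι) (a : K)
    (S' : C(ι → G, ℝ))
    (hrows : ∀ j, ∀ f' ∈ polyAlgebra (ι := ι) r,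
      (∀ U, HasDerivAt (fun t => v j (Function.update U i (k a t * U i))) (f' U) 0) →
        φ f' = β * φ (v j * S'))
    {f : C(ι → G, ℝ)} (hf : f ∈ Submodule.span ℝ (Set.range v)) {f' : C(ι → G, ℝ)}
    (hf' : ∀ U, HasDerivAt (fun t => f (Function.update U i (k a t * U i))) (f' U) 0) :
    φ f' = β * φ (f * S') := by
  classical
  obtain ⟨c, rfl⟩ := (Submodule.mem_span_range_iff_exists_fun ℝ).1 hf
  choose v' hv'm hv' using fun j => exists_deriv_mem_polyAlgebra r (hk a) (hX a) i (hv j)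
  -- the derivative of the combination is the combination of the derivatives
  have hd : ∀ U, HasDerivAt (fun t => (∑ j, c j • v j) (Function.update U i (k a t * U i)))
      ((∑ j, c j • v' j) U) 0 := fun U => by
    have h := HasDerivAt.sum (u := Finset.univ)
      (A := fun j t => c j * v j (Function.update U i (k a t * U i)))
      (A' := fun j => c j * v' j U) (x := (0 : ℝ)) fun j _ => (hv' j U).const_mul (c j)
    rw [Finset.sum_fn] at h
    simp only [ContinuousMap.coe_sum, ContinuousMap.coe_smul, Finset.sum_apply, Pi.smul_apply,
      smul_eq_mul]
    exact h
  have he : f' = ∑ j, c j • v' j := ContinuousMap.ext fun U => (hf' U).unique (hd U)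
  rw [he, map_sum, Finset.sum_mul, map_sum, Finset.mul_sum]
  refine Finset.sum_congr rfl fun j _ => ?_
  rw [map_smul, smul_eq_mul, hrows j (v' j) (hv'm j) (hv' j), smul_mul_assoc, map_smul, smul_eq_mul]
  ring

omit [Countable ι] [CompactSpace G] [MeasurableSpace G] [BorelSpace G] [SecondCountableTopology G] in
/-- ★★ **The truncated bootstrap with a finite family of polynomial test functions is a semidefinite
feasibility problem**: normalisation, positive semi-definiteness of the moment matrix, and the
finitely many loop equations with test functions `v_j`. [folklore] -/
theorem isBootstrapFeasible_span_iff (hk : ∀ a s t, k a (s + t) = k a s * k a t)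
    (hX : ∀ a t, r.ρ (k a t) = exp ((t : ℂ) • X a)) {v : σ → C(ι → G, ℝ)}
    (hv : ∀ j, v j ∈ polyAlgebra (ι := ι) r) (φ : C(ι → G, ℝ) →ₗ[ℝ] ℝ) :
    IsBootstrapFeasible r k S β (Submodule.span ℝ (Set.range v) : Set C(ι → G, ℝ)) φ ↔
      φ 1 = 1 ∧ (momentMatrix φ v).PosSemidef ∧
        ∀ (i : ι) (a : K), ∃ S' ∈ polyAlgebra (ι := ι) r,
          (∀ U, HasDerivAt (fun t => S i (Function.update U i (k a t * U i))) (S' U) 0) ∧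
            ∀ j, ∀ f' ∈ polyAlgebra (ι := ι) r,
              (∀ U, HasDerivAt (fun t => v j (Function.update U i (k a t * U i))) (f' U) 0) →
                φ f' = β * φ (v j * S') := by
  rw [IsBootstrapFeasible, ← sqPositive_span_iff_posSemidef]
  refine and_congr_right fun _ => and_congr Iff.rfl (forall_congr' fun i => forall_congr' fun a => ?_)
  constructor
  · rintro ⟨S', hS'm, hS', hrows⟩
    exact ⟨S', hS'm, hS', fun j => hrows (v j) (Submodule.subset_span ⟨j, rfl⟩)⟩
  · rintro ⟨S', hS'm, hS', hrows⟩
    exact ⟨S', hS'm, hS', fun f hf f' _ hf' => row_of_rows_span r hk hX hv i a S' hrows hf hf'⟩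

end SDP

end Summit.QuantumFields.GaugeBoot

end
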